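import Summits.QuantumFields.YangMills.Theorems.ColdStartUniversalityShenZhuZhuPlaquetteSU2
import Summits.QuantumFields.YangMills.Theorems.ColdStartUniversalityShenZhuZhuLoopFamiliesSU2
import Literature.MathematicalPhysics.QuantumFieldTheory.ShenZhuZhuPoincareApplications
import HarnessLib

/-!
# The LINK FIELD `⟨Q_e, E⟩ = Re Tr(Q_e E^*)` (Shen–Zhu–Zhu Cor. 4.7's observable, tree `linkHSComponent`) on every torus `(ℤ/L)³` of `SU(2)` lattice
# Yang–Mills at strong coupling: variance `≤ ‖E‖_F²/(1 − 12|β'|)`, Gaussian concentration, sub-Gaussian mgf — uniformly in the volume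

Seat `ym-line-csu-p1` (g38), route `ColdStartUniversality` of `Summits/QuantumFields/YangMills`, helper file G18 — the one-link instance of the torus
cylinder theorems (G10, G12, G14) in the vocabulary of Shen–Zhu–Zhu's Corollary 4.7 (`linkHSComponent ρ E e U = Re Tr(ρ(U_e) Eᴴ)`,
`ShenZhuZhuPoincareApplications`): the link field is `‖E‖_F`-Lipschitz in its link (Cauchy–Schwarz for the Hilbert–Schmidt pairing) and a smooth
(linear) matrix cylinder over one link.

* `exists_smooth_linkLipschitz_linkField` — `M ↦ Re Tr(M_{e₀} Eᴴ)` is a smooth `‖E‖_F`-Lipschitz cylinder over `{e₀}`.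
* ★★ `torus_linkField_variance_su2` — for `wilsonMeasure (fundamentalRep (Fin 2)) β'`, `|β'| < 1/12`, every `L`, every torus link `e`, every matrix `E`:
  `Var(⟨Q_e, E⟩) ≤ ‖E‖_F²/(1 − 12|β'|)`; for a unit `E` (`Re Tr(EE^*) = 1`, SZZ (2.3)) `≤ 1/(1 − 12|β'|)` — the diagonal input of Cor. 4.7's susceptibility
  bound (`Var ≤ γ/K_S`), sharp window, uniformly in `L`.
* ★★ `torus_linkField_twoSided_su2` — `μ_{L,β'}{|⟨Q_e,E⟩ − ⟨⟨Q_e,E⟩⟩| ≥ r} ≤ 2 exp(−(1 − 12|β'|) r²/(2‖E‖_F²))` (`E ≠ 0`).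
* ★★ `torus_linkField_hasSubgaussianMGF_su2` — `HasSubgaussianMGF (⟨Q_e,E⟩ − ⟨⟨Q_e,E⟩⟩) (‖E‖_F²/(1 − 12|β'|))`.

THEOREMS ONLY, no definition, no sorry.  HONEST FRAMING: STRONG coupling, fixed lattice, `SU(2)`, `d = 3`; the susceptibility SUM of Cor. 4.7 is NOT
proved (lattice symmetry); nothing at weak coupling / in the continuum, nothing `K`-uniform along the route's scaling (`UniformColdStartMixing`, 24809,
ASIDE, not restated); no crux, rung or summit statement is proved; the Yang–Mills mass gap is NOT proved.

References: H. Shen, R. Zhu, X. Zhu, CMP 400 (2023) 805–851 = arXiv:2204.12737, Cor. 4.7, (2.3) [ShenZhuZhu2022].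
-/

set_option autoImplicit false

noncomputable section

namespace Summit.QuantumFields.YangMills.Theorems.ColdStartUniversality

open MeasureTheory ProbabilityTheory Finset Filter Set Function
open scoped BigOperators NNReal ENNReal Topology Matrix Matrix.Norms.Frobenius ContDiff
open Literature.Probability.LatticeModels (Site Torus.proj Torus.proj_apply)
open Literature.Probability.Process Literature.MathematicalPhysics.QuantumFieldTheory
open Literature.MathematicalPhysics.QuantumLattice (fundamentalRep fundamentalLatticeRep continuous_fundamentalRep fundamentalRep_apply
  torusEdge torusLift LGConfig)

/-! ## §1. The link field is a smooth `‖E‖_F`-Lipschitz cylinder over one link -/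

/-- **The link field as a cylinder function**: for `e₀ ∈ E⁺(ℤ^d)` and a matrix `E`, `f(M) = Re Tr(M_{e₀} Eᴴ)` is a smooth function of the link
matrices over `{e₀}`, `‖E‖_F`-Lipschitz in the link `e₀` for the Frobenius distance (Cauchy–Schwarz `|Re Tr(AB)| ≤ ‖A‖_F‖B‖_F`), with
`matrixCylinder {e₀} f U = Re Tr(U_{e₀} Eᴴ)`. [cite: ShenZhuZhu2022, (2.3)] -/
theorem exists_smooth_linkLipschitz_linkField {d N : ℕ} (e₀ : Literature.MathematicalPhysics.QuantumLattice.ZdEdge d) (E : Matrix (Fin N) (Fin N) ℂ) :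
    ∃ f : (↥({e₀} : Finset (Literature.MathematicalPhysics.QuantumLattice.ZdEdge d)) → Matrix (Fin N) (Fin N) ℂ) → ℝ,
      ContDiff ℝ ∞ f ∧
      (∀ U : LGConfig d (Matrix.specialUnitaryGroup (Fin N) ℂ),
        matrixCylinder ({e₀} : Finset _) f U = (((U e₀ : Matrix.specialUnitaryGroup (Fin N) ℂ) : Matrix (Fin N) (Fin N) ℂ) * Eᴴ).trace.re) ∧
      (∀ (e : ↥({e₀} : Finset _)) (M M' : ↥({e₀} : Finset _) → Matrix.specialUnitaryGroup (Fin N) ℂ), (∀ e', e' ≠ e → M e' = M' e') →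
        |f (fun e' => (M e' : Matrix (Fin N) (Fin N) ℂ)) - f (fun e' => (M' e' : Matrix (Fin N) (Fin N) ℂ))| ≤
          frobNorm E * suFrobDist (M e) (M' e)) := by
  classical
  let i₀ : ↥({e₀} : Finset (Literature.MathematicalPhysics.QuantumLattice.ZdEdge d)) := ⟨e₀, Finset.mem_singleton_self e₀⟩
  refine ⟨fun m => (m i₀ * Eᴴ).trace.re, ?_, fun U => rfl, fun e M M' _ => ?_⟩
  · -- smooth: a continuous linear functional of the coordinate `m i₀`
    have hlin : ContDiff ℝ ∞ (fun M : Matrix (Fin N) (Fin N) ℂ => (M * Eᴴ).trace.re) := by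
      let T : Matrix (Fin N) (Fin N) ℂ →L[ℝ] ℝ :=
        LinearMap.toContinuousLinearMap
          { toFun := fun M => (M * Eᴴ).trace.re
            map_add' := fun A B => by simp [Matrix.add_mul, Matrix.trace_add]
            map_smul' := fun r A => by simp [Matrix.trace_smul] }
      exact T.contDiff
    exact hlin.comp (contDiff_apply ℝ (Matrix (Fin N) (Fin N) ℂ) i₀)
  · have he : e = i₀ := Subsingleton.elim _ _
    subst he
    show |((M i₀ : Matrix (Fin N) (Fin N) ℂ) * Eᴴ).trace.re - ((M' i₀ : Matrix (Fin N) (Fin N) ℂ) * Eᴴ).trace.re| ≤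
      frobNorm E * suFrobDist (M i₀) (M' i₀)
    rw [show ((M i₀ : Matrix (Fin N) (Fin N) ℂ) * Eᴴ).trace.re - ((M' i₀ : Matrix (Fin N) (Fin N) ℂ) * Eᴴ).trace.re =
      (((M i₀ : Matrix (Fin N) (Fin N) ℂ) - (M' i₀ : Matrix (Fin N) (Fin N) ℂ)) * Eᴴ).trace.re by
        rw [Matrix.sub_mul, Matrix.trace_sub, Complex.sub_re]]
    refine (abs_re_trace_mul_le _ _).trans (le_of_eq ?_)
    rw [frobNorm_conjTranspose, mul_comm]
    rfl

/-! ## §2. The link field on every torus, `|β'| < 1/12` -/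

/-- ★★ **Variance of the link field `⟨Q_e, E⟩` on every torus, uniformly in the volume**: for the periodic `SU(2)` Wilson measure on `(ℤ/L)³` at tree
coupling `|β'| < 1/12`, every torus link `e` and every matrix `E`: `Var_{L,β'}(Re Tr(Q_e Eᴴ)) ≤ ‖E‖_F²/(1 − 12|β'|)`.  The Yang–Mills mass gap is NOT
proved. [cite: ShenZhuZhu2022, Corollary 4.7] -/
theorem torus_linkField_variance_su2 {β' : ℝ} (hβ : |β'| < 1 / 12) (L : ℕ) [NeZero L] (e : Edge 3 L) (E : Matrix (Fin 2) (Fin 2) ℂ) :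
    Var[linkHSComponent (fundamentalRep (Fin 2)) E e; (wilsonMeasure (d := 3) (L := L) (fundamentalRep (Fin 2)) β')] ≤ frobNorm E ^ 2 / (1 - 12 * |β'|) := by
  classical
  set μ' : Measure (GaugeConfig 3 L (Matrix.specialUnitaryGroup (Fin 2) ℂ)) := (wilsonMeasure (d := 3) (L := L) (fundamentalRep (Fin 2)) β') with hμ'
  haveI : IsProbabilityMeasure μ' :=
    isProbabilityMeasure_wilsonMeasure (d := 3) (L := L) (fundamentalRep (Fin 2)) (continuous_fundamentalRep (Fin 2)) β'
  -- lift the torus link to `ℤ³`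
  set e₀ : Literature.MathematicalPhysics.QuantumLattice.ZdEdge 3 := (fun k => ((e.1 k).val : ℤ), e.2) with he₀
  have he : torusEdge (d := 3) L e₀ = e := by
    refine Prod.ext ?_ rfl
    funext k
    show Torus.proj L (fun k => ((e.1 k).val : ℤ)) k = e.1 k
    rw [Torus.proj_apply]
    simp only [Int.cast_natCast, ZMod.natCast_zmod_val]
  obtain ⟨f, hf, hrep, hLip⟩ := exists_smooth_linkLipschitz_linkField (N := 2) e₀ E
  have hinj : Set.InjOn (torusEdge (d := 3) L) ↑({e₀} : Finset (Literature.MathematicalPhysics.QuantumLattice.ZdEdge 3)) := by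
    rw [Finset.coe_singleton]; exact Set.injOn_singleton _ _
  have hW : ∀ V : (GaugeConfig 3 L (Matrix.specialUnitaryGroup (Fin 2) ℂ)), matrixCylinder ({e₀} : Finset _) f (torusLift L V) = linkHSComponent (fundamentalRep (Fin 2)) E e V := by
    intro V
    rw [hrep, linkHSComponent_apply, fundamentalRep_apply]
    show (((V (torusEdge (d := 3) L e₀) : Matrix.specialUnitaryGroup (Fin 2) ℂ) : Matrix (Fin 2) (Fin 2) ℂ) * Eᴴ).trace.re = _
    rw [he]
  have hWf : linkHSComponent (fundamentalRep (Fin 2)) E e = fun V : (GaugeConfig 3 L (Matrix.specialUnitaryGroup (Fin 2) ℂ)) => matrixCylinder ({e₀} : Finset _) f (torusLift L V) :=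
    funext fun V => (hW V).symm
  have hres : Continuous fun V : (GaugeConfig 3 L (Matrix.specialUnitaryGroup (Fin 2) ℂ)) =>
      (fun e' : ↥({e₀} : Finset (Literature.MathematicalPhysics.QuantumLattice.ZdEdge 3)) =>
        ((torusLift L V e'.1 : Matrix.specialUnitaryGroup (Fin 2) ℂ) : Matrix (Fin 2) (Fin 2) ℂ)) :=
    continuous_pi fun e' => continuous_subtype_val.comp (continuous_apply _)
  have hWm : AEMeasurable (linkHSComponent (fundamentalRep (Fin 2)) E e : (GaugeConfig 3 L (Matrix.specialUnitaryGroup (Fin 2) ℂ)) → ℝ) μ' := by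
    rw [hWf]; exact (hf.continuous.comp hres).measurable.aemeasurable
  rw [variance_eq_integral hWm]
  have h := torus_cylinder_variance_su2_uniform hβ L ({e₀} : Finset _) hinj f hf (fun _ => frobNorm E) (fun _ => frobNorm_nonneg _) hLip
  simp_rw [hW] at h
  simpa using h

/-- ★★ **SZZ's diagonal input of Corollary 4.7 for `SU(2)`, sharp window, every volume**: for a UNIT matrix `E` (`Re Tr(E E^*) = 1`, SZZ (2.3)) and every
torus link `e`, `Var_{L,β'}(⟨Q_e, E⟩) ≤ 1/(1 − 12|β'|)`.  The Yang–Mills mass gap is NOT proved. [cite: ShenZhuZhu2022, Corollary 4.7] -/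
theorem torus_linkField_variance_su2_unit {β' : ℝ} (hβ : |β'| < 1 / 12) (L : ℕ) [NeZero L] (e : Edge 3 L) (E : Matrix (Fin 2) (Fin 2) ℂ)
    (hE : (E * Eᴴ).trace.re = 1) :
    Var[linkHSComponent (fundamentalRep (Fin 2)) E e; (wilsonMeasure (d := 3) (L := L) (fundamentalRep (Fin 2)) β')] ≤ 1 / (1 - 12 * |β'|) := by
  have hn : frobNorm E ^ 2 = 1 := by rw [frobNorm_sq_eq_re_trace, Matrix.trace_mul_comm, hE]
  have h := torus_linkField_variance_su2 hβ L e E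
  rwa [hn] at h

/-- ★★ **Gaussian concentration of the link field on every torus, uniformly in the volume**: for `|β'| < 1/12`, every `L`, every torus link `e`, every
`E ≠ 0` and `r ≥ 0`: `μ_{L,β'}{|⟨Q_e,E⟩ − ⟨⟨Q_e,E⟩⟩| ≥ r} ≤ 2 exp(−(1 − 12|β'|) r²/(2‖E‖_F²))`.  The Yang–Mills mass gap is NOT proved.
[cite: ShenZhuZhu2022, Corollary 4.7] -/
theorem torus_linkField_twoSided_su2 {β' : ℝ} (hβ : |β'| < 1 / 12) (L : ℕ) [NeZero L] (e : Edge 3 L) {E : Matrix (Fin 2) (Fin 2) ℂ}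
    (hE : 0 < frobNorm E) {r : ℝ} (hr : 0 ≤ r) :
    ((wilsonMeasure (d := 3) (L := L) (fundamentalRep (Fin 2)) β')).real {V | r ≤ |linkHSComponent (fundamentalRep (Fin 2)) E e V -
        wilsonExpectation (d := 3) (L := L) (fundamentalRep (Fin 2)) β' (linkHSComponent (fundamentalRep (Fin 2)) E e)|} ≤
      2 * Real.exp (-((1 - 12 * |β'|) * r ^ 2 / (2 * frobNorm E ^ 2))) := by
  classical
  set e₀ : Literature.MathematicalPhysics.QuantumLattice.ZdEdge 3 := (fun k => ((e.1 k).val : ℤ), e.2) with he₀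
  have he : torusEdge (d := 3) L e₀ = e := by
    refine Prod.ext ?_ rfl
    funext k
    show Torus.proj L (fun k => ((e.1 k).val : ℤ)) k = e.1 k
    rw [Torus.proj_apply]
    simp only [Int.cast_natCast, ZMod.natCast_zmod_val]
  obtain ⟨f, hf, hrep, hLip⟩ := exists_smooth_linkLipschitz_linkField (N := 2) e₀ E
  have hinj : Set.InjOn (torusEdge (d := 3) L) ↑({e₀} : Finset (Literature.MathematicalPhysics.QuantumLattice.ZdEdge 3)) := by
    rw [Finset.coe_singleton]; exact Set.injOn_singleton _ _
  have hW : ∀ V : (GaugeConfig 3 L (Matrix.specialUnitaryGroup (Fin 2) ℂ)), matrixCylinder ({e₀} : Finset _) f (torusLift L V) = linkHSComponent (fundamentalRep (Fin 2)) E e V := by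
    intro V
    rw [hrep, linkHSComponent_apply, fundamentalRep_apply]
    show (((V (torusEdge (d := 3) L e₀) : Matrix.specialUnitaryGroup (Fin 2) ℂ) : Matrix (Fin 2) (Fin 2) ℂ) * Eᴴ).trace.re = _
    rw [he]
  have hS : 0 < ∑ _e : ↥({e₀} : Finset (Literature.MathematicalPhysics.QuantumLattice.ZdEdge 3)), frobNorm E ^ 2 := by
    simp only [Finset.univ_unique, Finset.sum_const, Finset.card_singleton, one_smul]
    positivity
  have h := torus_twoSided_su2_uniform hβ L ({e₀} : Finset _) hinj f hf (fun _ => frobNorm E) (fun _ => frobNorm_nonneg _) hS hLip hr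
  simp_rw [hW] at h
  have hsum : ∑ _e : ↥({e₀} : Finset (Literature.MathematicalPhysics.QuantumLattice.ZdEdge 3)), frobNorm E ^ 2 = frobNorm E ^ 2 := by
    simp
  rw [hsum] at h
  exact h

/-- ★★ **Sub-Gaussian mgf of the centred link field on every torus** (Mathlib's `HasSubgaussianMGF`): proxy `‖E‖_F²/(1 − 12|β'|)`, the same for every
`L`, `|β'| < 1/12`.  The Yang–Mills mass gap is NOT proved. [cite: ShenZhuZhu2022, Corollary 4.7] -/
theorem torus_linkField_hasSubgaussianMGF_su2 {β' : ℝ} (hβ : |β'| < 1 / 12) (L : ℕ) [NeZero L] (e : Edge 3 L) (E : Matrix (Fin 2) (Fin 2) ℂ) :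
    HasSubgaussianMGF (fun V => linkHSComponent (fundamentalRep (Fin 2)) E e V -
        wilsonExpectation (d := 3) (L := L) (fundamentalRep (Fin 2)) β' (linkHSComponent (fundamentalRep (Fin 2)) E e))
      ((frobNorm E ^ 2) / (1 - 12 * |β'|)).toNNReal (wilsonMeasure (d := 3) (L := L) (fundamentalRep (Fin 2)) β') := by
  classical
  set e₀ : Literature.MathematicalPhysics.QuantumLattice.ZdEdge 3 := (fun k => ((e.1 k).val : ℤ), e.2) with he₀
  have he : torusEdge (d := 3) L e₀ = e := by
    refine Prod.ext ?_ rfl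
    funext k
    show Torus.proj L (fun k => ((e.1 k).val : ℤ)) k = e.1 k
    rw [Torus.proj_apply]
    simp only [Int.cast_natCast, ZMod.natCast_zmod_val]
  obtain ⟨f, hf, hrep, hLip⟩ := exists_smooth_linkLipschitz_linkField (N := 2) e₀ E
  have hinj : Set.InjOn (torusEdge (d := 3) L) ↑({e₀} : Finset (Literature.MathematicalPhysics.QuantumLattice.ZdEdge 3)) := by
    rw [Finset.coe_singleton]; exact Set.injOn_singleton _ _
  have hW : ∀ V : (GaugeConfig 3 L (Matrix.specialUnitaryGroup (Fin 2) ℂ)), matrixCylinder ({e₀} : Finset _) f (torusLift L V) = linkHSComponent (fundamentalRep (Fin 2)) E e V := by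
    intro V
    rw [hrep, linkHSComponent_apply, fundamentalRep_apply]
    show (((V (torusEdge (d := 3) L e₀) : Matrix.specialUnitaryGroup (Fin 2) ℂ) : Matrix (Fin 2) (Fin 2) ℂ) * Eᴴ).trace.re = _
    rw [he]
  have h := torus_hasSubgaussianMGF_su2_uniform hβ L ({e₀} : Finset _) hinj f hf (fun _ => frobNorm E) (fun _ => frobNorm_nonneg _) hLip
  simp_rw [hW] at h
  have hsum : ∑ _e : ↥({e₀} : Finset (Literature.MathematicalPhysics.QuantumLattice.ZdEdge 3)), frobNorm E ^ 2 = frobNorm E ^ 2 := by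
    simp
  rw [hsum] at h
  exact h

end Summit.QuantumFields.YangMills.Theorems.ColdStartUniversality

end
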